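import Literature.NumberTheory.EllipticCurves.LeadingTermBSZAssemblyProofs
import HarnessLib

/-!
# bsd.S27 (Bhargava–Skinner–Zhang): Cor 26 assembled with a fourth piece counted through the local
# equidistribution of Selmer elements (Bhargava–Skinner), and the constant `0.66856…`

Third sibling proof file of `Literature.NumberTheory.EllipticCurves.LeadingTerm` for the rank part of
BSD by naive height (`HeightDensityGE SatisfiesBSDRankLeOne δ`: a lower density `≥ δ` of the curves
`E_{A,B} : y² = x³ + Ax + B` over `ℚ` have `rank = ord_{s=1} L ∈ {0, 1}` and finite `Ш`).
`LeadingTermBSZProofs.lean` proves the counting theorems (Thms 21, 23, 25) of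

> M. Bhargava, C. Skinner, W. Zhang, *A majority of elliptic curves over `ℚ` satisfy the Birch and
> Swinnerton-Dyer conjecture*, arXiv:1407.1826v2 (2014), Cor 26 (proof, pp. 10–13),

at a finite height, and `LeadingTermBSZAssemblyProofs.lean` proves the bookkeeping of Cor 26 for
abstract pieces (`heightDensityGE_satisfiesBSDRankLeOne_of_pieces`: pieces `T ⊇ U`, `R ⊇ U₀` of
`S₀ = S₀(5)`, constant `(19/24 + κ/12)·μT + 3/8·κ·μR - ν`; `0.6597` with the corrected density of
`S₁'(5)`). In Cor 26 the part `R = S₀(5) ∖ S₁'(5)` ("on which the above arguments have not been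
applied") is only run through Thm 21 (the rank-`0` converse on the root-number-equidistributed
subfamily of Thm 16: `3/8·κ` of it). This file adds ONE further mode for a piece `P ⊆ S₀` disjoint
from `T` and `R`, taken from

> M. Bhargava, C. Skinner, *A positive proportion of elliptic curves over `ℚ` have rank one*,
> J. Ramanujan Math. Soc. 29 (2014) 221–242 (= arXiv:1401.0233), Thm 7 (ii) and Lemma 16:
> inside a large family the images of the non-identity `5`-Selmer elements under
> `Sel₅(E) → E(ℚ₅)/5E(ℚ₅)` are equidistributed; with the average `#Sel₅ = 6`
> (Bhargava–Shankar, arXiv:1312.7859, Thm 31) the number of non-identity `5`-Selmer elements with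
> trivial image at `5` is on average `(#E(ℚ₅)[5] / #E(ℚ₅)/5E(ℚ₅))·5 = 1` on a family on which
> `E(ℚ₅)[5] = 0` (proof of Lemma 16),

combined with a rank-`1` converse theorem carrying a LOCAL hypothesis at `5`,

> C.-H. Kim, Math. Ann. 387 (2023) 1961–1968 (= arXiv:2109.12344v3), Thm 1.1: for any `E/ℚ` and
> prime `p`, if `cork_{ℤ_p} Sel_{p^∞}(E/ℚ) = 1`
> (`cork1`), Perrin-Riou's conjecture on Kato's zeta element holds (`PRC`; a theorem for `E`
> semistable at an odd `p`: Thm 2.3 there = Bertolini–Darmon–Venerucci, Adv. Math. 398 (2022),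
> Thm A), the Iwasawa main conjecture with `p` inverted holds (`IMC[1/p]`), and the restriction
> `res_p : Sel(ℚ, V_pE) → E(ℚ_p) ⊗ ℚ_p` is an isomorphism (`res`), then `ord_{s=1} L(E,s) = 1`,

exactly as these two inputs are combined in the `pub-bsdpct` bundle (its Lean package `BSDPercentage`,
files `LocalCondition.lean` — the linear programme `card_good_res_ge` — and `MultiplicativeSlice.lean`,
Theorem A′; the package is not part of this tree and proves nothing about elliptic curves: every
arithmetic input there is a named hypothesis on abstract invariants). Here the same argument is run on
the tree's ACTUAL objects (`shortWeierstrass AB`, its `selmerGroup 5`, `mordellWeilRank`,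
`analyticRank`, `rootNumber`), the deep inputs being explicit hypotheses in the shape the counting
consumes, as in the two sibling files. No definition and no named fact is introduced (D-0026).

## The fourth mode (the device, per curve and at a finite height)

For a curve `E` of the piece `P` write `Z(E) ≤ Sel₅(E)` for the kernel of
`res₅ : Sel₅(E) → E(ℚ₅)/5E(ℚ₅)` (an abstract subgroup `Z AB` below) and suppose
`#Sel₅(E) ≤ 5 · #Z(E)` (`hker`; this is `[Sel₅(E) : Z(E)] ≤ #E(ℚ₅)/5E(ℚ₅) = 5`, which holds as soon
as `E(ℚ₅)[5] = 0` — on the bundle's piece `SP′` (multiplicative reduction at `5` outside `S₁'(5)` and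
outside the Tate-fifth-power set) this is its Lemma 4.3, for EVERY curve of the piece). Call `E`
*good* if `#Sel₅(E) = 1`, or `#Sel₅(E) = 5` and `Z(E) = 0`. Since `#Sel₅(E)` is `1`, `5` or `≥ 25`
(`natCard_selmerGroup_le_iff`, `sq_le_natCard_selmerGroup_of_lt`) and `#Z(E) ∣ #Sel₅(E)`, a curve that
is not good has `#Z(E) ≥ 5`: pointwise `4·[E good] + (#Z(E) - 1) ≥ 4` (`resCell_pointwise`). Summing
over the members of `P` of height `< X` and using the local equidistribution count
`Σ_P (#Z(E) - 1) ≤ (1 + η)·N_P` (`hloc`) gives `4·#{E ∈ P good} ≥ (3 - η)·N_P` (`resCell_count`) —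
with NO root-number input and NO parity. A good curve of `P ∩ W` satisfies BSD with rank `≤ 1`: if
`#Sel₅ = 1` by the rank-`0` converse (Thm 5 of the source, `h5`, available on all of `S₀ ∩ W`), if
`#Sel₅ = 5` and `Z = 0` by the rank-`1` converse under the local condition (`hKim`: analytic rank `1`,
then Gross–Zagier–Kolyvagin) — `E(ℚ)[5] = 0` (from `W`) and `#Sel₅ = 5` give
`Sel_{5^∞}(E) ≅ ℚ₅/ℤ₅`, i.e. (`cork1`), and `Z = 0` gives (`res`) (bundle `AUDIT.md` §F5, H6, H10).

## The assembly and the constant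

* `cor26res_count`: `(19-η)/24·N_T + N_U/12 + (3/8 - η/24)·N_{U₀} + (3/4 - η/4)·N_P - 19/6·N_{¬W}
  - N_{T∖S₁} ≤ #{E : SatisfiesBSDRankLeOne}` (the three events "`E ∈ T`, `#Sel₅ ≤ 5`",
  "`E ∈ U₀`, `#Sel₅ = 1`", "`E ∈ P` good" are pairwise exclusive and each gives BSD off `T ∖ S₁` and
  off the complement of `W`).
* `cor26res_algebra`, `heightDensityGE_satisfiesBSDRankLeOne_of_resPieces`: lower density
  `δ ≤ (19/24 + κ/12)·μT + 3/8·κ·μR + 3/4·μP - ν`.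
* `bsz_rankLeOne_cRank_of_pieces`: with the bundle's audited exact densities — `μT = μ(S₁'(5)) =
  747265625/953369043 = .78381…` (Lemma 18 of the source with the residue count corrected, cf.
  `bsz_mu_S_one_prime_five`), `μR = μ(T₅) = 78125/3813476172 = 2.05·10⁻⁵` (the Tate-fifth-power
  set: split multiplicative at `5`, `5 ∣ ord₅ Δ`, `E(ℚ₅)[5] ≠ 0`; rank-`0` mode), `μP = μ(SP′) - 10⁻⁶
  = 20546875/1271158724 - 10⁻⁶` (`SP′ = S₀(5) ∖ (S₁'(5) ∪ T₅)`, truncated at `ord₅ Δ ≤ K`, `K ≥ 9`,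
  so that its `5`-adic condition set is compact as Bhargava–Skinner's count requires; tail
  `4c₅/5^{K+2} < 10⁻⁶`), `κ = .5501` (Thm 16), `ν = 10⁻⁵` (display (2)) — the bound is
  `.6685685… ≥ 3059480216411717/4576171406400000 = .66856766…`, the constant `c_rank` of the bundle's
  Theorem A′, which is EXACTLY `(19/24 + κ/12)·μ(S₁'(5)) + 3/8·κ·μ(T₅) + 3/4·μ(SP′) - 7/6·10⁻⁵`
  (`bsz_cRank_eq`: it charges `ν` with the coefficient `7/6` and carries NO truncation charge; this
  file charges `ν` once, as `cor26_algebra` does, and the truncation `10⁻⁶` with the coefficient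
  `3/4` — whence the margin `7/6·10⁻⁵ - 10⁻⁵ - 3/4·10⁻⁶ = 9.1(6)·10⁻⁷`). The three audited densities
  partition Lemma 17's `μ(S₀(5)) = 4·5¹⁰/(5(5¹⁰ - 1))` exactly:
  `μ(S₁'(5)) + μ(T₅) + μ(SP′) = 1953125/2441406` (`bsz_resCell_partition_value`; the constant of
  `hasHeightDensity_not_five_dvd` in `LeadingTermBSZLocalDensityProofs`). The conclusion is LITERALLY
  the hypothesis `hA` of `heightDensityGE_rankLeOne_and_fullBSDOffSgoPrime_cRank_of_sieve` (row (ii-1)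
  of the bundle's `PERCENT-FULL.md`) and of
  `heightDensityGE_rankLeOne_and_fullBSDOffSmPrime_cRank_of_sieve` (row (ii-2)); the composition is
  `HeightDensityFullBSDOffSAprimePieces.lean`.

## References

* [BhargavaSkinnerZhang2014] M. Bhargava, C. Skinner, W. Zhang, arXiv:1407.1826v2: Thms 5, 9, 13, 15,
  16, Lemmas 17–20, Thms 21, 25, Cor 26 (proof), display (2).
* [BhargavaSkinner2014] M. Bhargava, C. Skinner, J. Ramanujan Math. Soc. 29 (2014) 221–242
  (arXiv:1401.0233): Thm 7 (ii), Lemma 16.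
* [BhargavaShankar5Selmer2013] M. Bhargava, A. Shankar, arXiv:1312.7859, Thm 31 and §5.
* [Kim2022] C.-H. Kim, Math. Ann. 387 (2023) 1961–1968 (arXiv:2109.12344v3), Thm 1.1, Thm 2.3.
* [BertoliniDarmonVenerucci2022] M. Bertolini, H. Darmon, R. Venerucci, Adv. Math. 398 (2022) 108172,
  Thm A.
* [Skinner2016PacificMC] C. Skinner, Pacific J. Math. 283 (2016) 171–200, Thm A, Thm C.
* [DokchitserDokchitserAnnals2010] T. Dokchitser, V. Dokchitser, Ann. of Math. 172 (2010), Thm 1.4.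
* [Darmon2004] H. Darmon, CBMS 101, Thm. 3.22 (Gross–Zagier–Kolyvagin).
-/

noncomputable section

open scoped Classical
open scoped AddSubgroup
open Filter Topology WeierstrassCurve

namespace Literature.NumberTheory.EllipticCurves

/-! ### The device per curve: `4·[good] + (#Z - 1) ≥ 4` -/

section PerCurve

variable (W : WeierstrassCurve ℚ) [W.IsElliptic] (p : ℕ) [Fact p.Prime]

/-- **The local-condition device, pointwise** (Bhargava–Skinner, proof of Lemma 16; the bundle's
`pow_ge_res`). Let `Z ≤ Sel_p(E)` be a subgroup with `#Sel_p(E) ≤ p·#Z` (for `Z = ker res_p` this is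
`[Sel_p(E) : Z] ≤ #E(ℚ_p)/pE(ℚ_p) = p`, i.e. `E(ℚ_p)[p] = 0`). Then
`(p-1)·[#Sel_p(E) = 1 ∨ (#Sel_p(E) = p ∧ #Z = 1)] + (#Z - 1) ≥ p - 1`: if the bracket fails then
either `#Sel_p(E) = p` and `1 ≠ #Z ∣ p`, or `#Sel_p(E) ≥ p²`; in both cases `#Z ≥ p`.
[cite: BhargavaSkinner2014, Lemma 16 (proof)] -/
theorem resCell_pointwise (Z : AddSubgroup (W.selmerGroup p))
    (hZ : Nat.card (W.selmerGroup p) ≤ p * Nat.card Z) :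
    (p : ℝ) - 1 ≤
      ((p : ℝ) - 1) * (if Nat.card (W.selmerGroup p) = 1 ∨
          (Nat.card (W.selmerGroup p) = p ∧ Nat.card Z = 1) then 1 else 0) +
        ((Nat.card Z : ℝ) - 1) := by
  have hp : p.Prime := Fact.out
  have hp2 : (2 : ℝ) ≤ p := by exact_mod_cast hp.two_le
  have hS1 : 1 ≤ Nat.card (W.selmerGroup p) := one_le_natCard_selmerGroup W p
  haveI : Finite (W.selmerGroup p) := Nat.finite_of_card_ne_zero (by omega)
  haveI : Finite Z := inferInstance
  have hZ1 : 1 ≤ Nat.card Z := Nat.one_le_iff_ne_zero.mpr Nat.card_pos.ne'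
  have hZ1' : (1 : ℝ) ≤ Nat.card Z := by exact_mod_cast hZ1
  split_ifs with h
  · linarith
  · rw [mul_zero, zero_add]
    suffices hpZ : p ≤ Nat.card Z by
      have : (p : ℝ) ≤ Nat.card Z := by exact_mod_cast hpZ
      linarith
    push Not at h
    by_cases hle : Nat.card (W.selmerGroup p) ≤ p
    · rcases (natCard_selmerGroup_le_iff W p).mp hle with h1 | hp'
      · exact absurd h1 h.1
      · have hZne : Nat.card Z ≠ 1 := h.2 hp'
        have hdvd : Nat.card Z ∣ Nat.card (W.selmerGroup p) := Z.card_addSubgroup_dvd_card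
        rw [hp'] at hdvd
        rcases (Nat.dvd_prime hp).mp hdvd with h1 | hpp
        · exact absurd h1 hZne
        · exact hpp.ge
    · push Not at hle
      have hsq := sq_le_natCard_selmerGroup_of_lt W p hle
      have hmul : p * p ≤ p * Nat.card Z := by rw [← sq]; exact hsq.trans hZ
      exact Nat.le_of_mul_le_mul_left hmul hp.pos

end PerCurve

/-! ### The device at a finite height: `4·#{good} ≥ (3 - η)·N_P` -/

section Count

/-- **The local-condition linear programme at height `X`, `p = 5`** (Bhargava–Skinner, Lemma 16, as
used in the bundle's Prop. 3.3 / `card_good_res_ge`). For a subfamily `P` with subgroups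
`Z(E) ≤ Sel₅(E)` of index `≤ 5` (`hker`: `#Sel₅(E) ≤ 5·#Z(E)`) whose non-identity elements number on
average `≤ 1 + η` over the members of `P` of height `< X` (`hloc`, the local equidistribution count),
`(3 - η)·N_P ≤ 4·#{E ∈ P, H(E) < X : #Sel₅(E) = 1 ∨ (#Sel₅(E) = 5 ∧ #Z(E) = 1)}`.
[cite: BhargavaSkinner2014, Thm 7 (ii) and Lemma 16] -/
theorem resCell_count (P : ℤ × ℤ → Prop)
    (Z : (AB : ℤ × ℤ) → AddSubgroup ((shortWeierstrass AB).selmerGroup 5))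
    (hker : ∀ AB, IsInHeightFamily AB → P AB →
      Nat.card ((shortWeierstrass AB).selmerGroup 5) ≤ 5 * Nat.card (Z AB))
    (X : ℕ) {η : ℝ}
    (hloc : ∑ AB ∈ (heightFamilyBelow X).filter P, ((Nat.card (Z AB) : ℝ) - 1) ≤
      (1 + η) * ((heightFamilyBelow X).filter P).card) :
    (3 - η) * ((heightFamilyBelow X).filter P).card ≤
      4 * (((heightFamilyBelow X).filter P).filter (fun AB ↦
        Nat.card ((shortWeierstrass AB).selmerGroup 5) = 1 ∨
          (Nat.card ((shortWeierstrass AB).selmerGroup 5) = 5 ∧ Nat.card (Z AB) = 1))).card := by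
  haveI : Fact (Nat.Prime 5) := ⟨by norm_num⟩
  set s := (heightFamilyBelow X).filter P with hs_def
  have hsum : ∑ AB ∈ s, ((5 : ℝ) - 1) ≤
      ∑ AB ∈ s, (((5 : ℝ) - 1) * (if Nat.card ((shortWeierstrass AB).selmerGroup 5) = 1 ∨
          (Nat.card ((shortWeierstrass AB).selmerGroup 5) = 5 ∧ Nat.card (Z AB) = 1) then 1 else 0) +
        ((Nat.card (Z AB) : ℝ) - 1)) := by
    refine Finset.sum_le_sum fun AB hAB ↦ ?_
    have hmem := Finset.mem_filter.mp hAB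
    have hfam : IsInHeightFamily AB := ((mem_heightFamilyBelow_iff AB X).mp hmem.1).1
    haveI := isElliptic_shortWeierstrass hfam
    have h := resCell_pointwise (shortWeierstrass AB) 5 (Z AB) (hker AB hfam hmem.2)
    simp only [Nat.cast_ofNat] at h
    exact h
  rw [Finset.sum_add_distrib, ← Finset.mul_sum, Finset.sum_boole] at hsum
  have h1 : ∑ AB ∈ s, ((5 : ℝ) - 1) = 4 * s.card := by
    rw [Finset.sum_const, nsmul_eq_mul]; ring
  rw [h1] at hsum
  linarith

/-- Truth-table lemma for the inclusion–exclusion step of `cor26res_count`: three pairwise exclusive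
events each implying `g` off the exceptional events `q₁`, `q₂`. [folklore] -/
private theorem ite3_add_le_of_imp {p₁ p₂ p₃ g q₁ q₂ : Prop} [Decidable p₁] [Decidable p₂]
    [Decidable p₃] [Decidable g] [Decidable q₁] [Decidable q₂] (h₁ : p₁ → ¬ q₁ → ¬ q₂ → g)
    (h₂ : p₂ → ¬ q₂ → g) (h₃ : p₃ → ¬ q₂ → g) (h₁₂ : ¬ (p₁ ∧ p₂)) (h₁₃ : ¬ (p₁ ∧ p₃))
    (h₂₃ : ¬ (p₂ ∧ p₃)) :
    (if p₁ then (1 : ℝ) else 0) + (if p₂ then (1 : ℝ) else 0) + (if p₃ then (1 : ℝ) else 0) ≤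
      (if g then (1 : ℝ) else 0) + (if q₁ then (1 : ℝ) else 0) + (if q₂ then (1 : ℝ) else 0) := by
  split_ifs <;> norm_num <;> tauto

/-- **Cor 26 of the source with a fourth piece in the local-condition mode, at a finite height `X`.**
Data as in `cor26_count` — `T ⊆ S₀` (the source's `S₀(5) ∩ S₁'(5)`), `U ⊆ T` (Thm 16 inside it),
`R ⊆ S₀` disjoint from `T` with `U₀ ⊆ R` (Thm 16 inside it), `S₁` (the source's `S₁(5)`), `W` (the
`100%` conditions), `U`, `U₀` stable under `E ↦ E₋₁` with reversed root number, Thm 5 (`h5`, on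
`S₀ ∩ W`), Thm 9 (`h9`, on `T ∩ S₁ ∩ W`), rational `5`-torsion excluded on `W` (`hWtors`), Thm 15
(`hDD`), Gross–Zagier–Kolyvagin (`hGZK`), Thm 13 at height `X` on `T` and on `U₀` (`hsumT`, `hsumU₀`)
— plus a piece `P ⊆ S₀` disjoint from `T` and from `R` with subgroups `Z(E) ≤ Sel₅(E)` of index `≤ 5`
(`hker`), the local equidistribution count at height `X` (`hloc`) and the rank-`1` converse under the
local condition on `P ∩ W` (`hKim`: `#Sel₅(E) = 5`, `Z(E) = 0` ⟹ `rank = an.rank = 1`). Then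
`(19-η)/24 · N_T + N_U/12 + (3/8 - η/24) · N_{U₀} + (3/4 - η/4) · N_P - 19/6 · N_{¬W} - N_{T ∖ S₁}
≤ #{E : H(E) < X, E ∈ SatisfiesBSDRankLeOne}`.
[cite: BhargavaSkinnerZhang2014, Cor 26 (proof), with Thms 5, 9, 21, 25 and Lemma 20]
[cite: BhargavaSkinner2014, Thm 7 (ii) and Lemma 16] [cite: Kim2022, Thm 1.1] -/
theorem cor26res_count (hGZK : rank_eq_analyticRank_of_analyticRank_le_one)
    (hDD : even_selmerRank_sub_torsionRank_iff) (S₀ T U R U₀ P S₁ W : ℤ × ℤ → Prop)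
    (Z : (AB : ℤ × ℤ) → AddSubgroup ((shortWeierstrass AB).selmerGroup 5))
    (hTS₀ : ∀ AB, T AB → S₀ AB) (hUT : ∀ AB, U AB → T AB)
    (hRS₀ : ∀ AB, R AB → S₀ AB) (hRT : ∀ AB, R AB → ¬ T AB) (hU₀R : ∀ AB, U₀ AB → R AB)
    (hPS₀ : ∀ AB, P AB → S₀ AB) (hPT : ∀ AB, P AB → ¬ T AB) (hPR : ∀ AB, P AB → ¬ R AB)
    (hU : ∀ AB, U AB → U (negB AB))
    (hUflip : ∀ AB, U AB →
      (shortWeierstrass (negB AB)).rootNumber = -(shortWeierstrass AB).rootNumber)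
    (hU₀ : ∀ AB, U₀ AB → U₀ (negB AB))
    (hU₀flip : ∀ AB, U₀ AB →
      (shortWeierstrass (negB AB)).rootNumber = -(shortWeierstrass AB).rootNumber)
    (h5 : ∀ AB, IsInHeightFamily AB → S₀ AB → W AB →
      Nat.card ((shortWeierstrass AB).selmerGroup 5) = 1 →
        (shortWeierstrass AB).mordellWeilRank = 0 ∧ (shortWeierstrass AB).analyticRank = 0)
    (h9 : ∀ AB, IsInHeightFamily AB → T AB → S₁ AB → W AB →
      Nat.card ((shortWeierstrass AB).selmerGroup 5) = 5 →
        (shortWeierstrass AB).mordellWeilRank = 1 ∧ (shortWeierstrass AB).analyticRank = 1)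
    (hker : ∀ AB, IsInHeightFamily AB → P AB →
      Nat.card ((shortWeierstrass AB).selmerGroup 5) ≤ 5 * Nat.card (Z AB))
    (hKim : ∀ AB, IsInHeightFamily AB → P AB → W AB →
      Nat.card ((shortWeierstrass AB).selmerGroup 5) = 5 → Nat.card (Z AB) = 1 →
        (shortWeierstrass AB).mordellWeilRank = 1 ∧ (shortWeierstrass AB).analyticRank = 1)
    (hWtors : ∀ AB, IsInHeightFamily AB → W AB → (shortWeierstrass AB).toAffine.Point[(5 : ℤ)] = ⊥)
    (X : ℕ) {η : ℝ}
    (hsumT : ∑ AB ∈ (heightFamilyBelow X).filter T,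
        (Nat.card ((shortWeierstrass AB).selmerGroup 5) : ℝ) ≤
      (6 + η) * ((heightFamilyBelow X).filter T).card)
    (hsumU₀ : ∑ AB ∈ (heightFamilyBelow X).filter U₀,
        (Nat.card ((shortWeierstrass AB).selmerGroup 5) : ℝ) ≤
      (6 + η) * ((heightFamilyBelow X).filter U₀).card)
    (hloc : ∑ AB ∈ (heightFamilyBelow X).filter P, ((Nat.card (Z AB) : ℝ) - 1) ≤
      (1 + η) * ((heightFamilyBelow X).filter P).card) :
    (19 - η) / 24 * ((heightFamilyBelow X).filter T).card +
          (1 / 12) * ((heightFamilyBelow X).filter U).card +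
          (3 / 8 - η / 24) * ((heightFamilyBelow X).filter U₀).card +
          (3 / 4 - η / 4) * ((heightFamilyBelow X).filter P).card -
          (19 / 6) * ((heightFamilyBelow X).filter (fun AB ↦ ¬ W AB)).card -
          ((heightFamilyBelow X).filter (fun AB ↦ T AB ∧ ¬ S₁ AB)).card ≤
      ((heightFamilyBelow X).filter SatisfiesBSDRankLeOne).card := by
  haveI : Fact (Nat.Prime 5) := ⟨by norm_num⟩
  set s := heightFamilyBelow X with hs_def
  -- the three counting theorems (their `(5 : ℕ)` casts are definitionally the literal `5`)
  have h25 := thm25_count_five hDD T U hUT hU hUflip X (η := η) hsumT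
  have h21 := thm21_count_five hDD U₀ hU₀ hU₀flip X (η := η) hsumU₀
  simp only [Nat.cast_ofNat] at h25 h21
  have hP := resCell_count P Z hker X hloc
  -- rational `5`-torsion only occurs off `W`
  have hB : ∀ Q : ℤ × ℤ → Prop, (((s.filter Q).filter
      (fun AB ↦ (shortWeierstrass AB).toAffine.Point[(5 : ℤ)] ≠ ⊥)).card : ℝ) ≤
      (s.filter (fun AB ↦ ¬ W AB)).card := by
    intro Q
    exact_mod_cast Finset.card_le_card fun AB h ↦ by
      simp only [Finset.mem_filter] at h ⊢
      exact ⟨h.1.1, fun hW ↦ h.2 (hWtors AB ((mem_heightFamilyBelow_iff AB X).mp h.1.1).1 hW)⟩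
  have hBT := hB T
  have hBU₀ := hB U₀
  -- inclusion–exclusion, pointwise
  have key : ∀ AB ∈ s,
      (if T AB ∧ Nat.card ((shortWeierstrass AB).selmerGroup 5) ≤ 5 then (1 : ℝ) else 0) +
        (if U₀ AB ∧ Nat.card ((shortWeierstrass AB).selmerGroup 5) = 1 then (1 : ℝ) else 0) +
        (if P AB ∧ (Nat.card ((shortWeierstrass AB).selmerGroup 5) = 1 ∨
            (Nat.card ((shortWeierstrass AB).selmerGroup 5) = 5 ∧ Nat.card (Z AB) = 1))
          then (1 : ℝ) else 0) ≤
      (if SatisfiesBSDRankLeOne AB then (1 : ℝ) else 0) +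
        (if T AB ∧ ¬ S₁ AB then (1 : ℝ) else 0) + (if ¬ W AB then (1 : ℝ) else 0) := by
    intro AB hAB
    have hfam : IsInHeightFamily AB := ((mem_heightFamilyBelow_iff AB X).mp hAB).1
    haveI := isElliptic_shortWeierstrass hfam
    refine ite3_add_le_of_imp ?_ ?_ ?_ ?_ ?_ ?_
    · rintro ⟨hT, hle⟩ hq₁ hq₂
      have hW : W AB := not_not.mp hq₂
      have hS₁ : S₁ AB := by
        by_contra hS₁
        exact hq₁ ⟨hT, hS₁⟩
      rcases (natCard_selmerGroup_le_iff (shortWeierstrass AB) 5).mp hle with h1 | h5'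
      · exact satisfiesBSDRankLeOne_of_rank_eq hGZK hfam zero_le_one
          (h5 AB hfam (hTS₀ AB hT) hW h1)
      · exact satisfiesBSDRankLeOne_of_rank_eq hGZK hfam le_rfl (h9 AB hfam hT hS₁ hW h5')
    · rintro ⟨hU₀AB, h1⟩ hq₂
      exact satisfiesBSDRankLeOne_of_rank_eq hGZK hfam zero_le_one
        (h5 AB hfam (hRS₀ AB (hU₀R AB hU₀AB)) (not_not.mp hq₂) h1)
    · rintro ⟨hPAB, hgood⟩ hq₂
      have hW : W AB := not_not.mp hq₂
      rcases hgood with h1 | ⟨h5', hZ1⟩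
      · exact satisfiesBSDRankLeOne_of_rank_eq hGZK hfam zero_le_one
          (h5 AB hfam (hPS₀ AB hPAB) hW h1)
      · exact satisfiesBSDRankLeOne_of_rank_eq hGZK hfam le_rfl (hKim AB hfam hPAB hW h5' hZ1)
    · rintro ⟨⟨hT, -⟩, hU₀AB, -⟩
      exact hRT AB (hU₀R AB hU₀AB) hT
    · rintro ⟨⟨hT, -⟩, hPAB, -⟩
      exact hPT AB hPAB hT
    · rintro ⟨⟨hU₀AB, -⟩, hPAB, -⟩
      exact hPR AB hPAB (hU₀R AB hU₀AB)
  have hsum := Finset.sum_le_sum key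
  rw [Finset.sum_add_distrib, Finset.sum_add_distrib, Finset.sum_add_distrib,
    Finset.sum_add_distrib, Finset.sum_boole, Finset.sum_boole, Finset.sum_boole, Finset.sum_boole,
    Finset.sum_boole, Finset.sum_boole] at hsum
  rw [← Finset.filter_filter, ← Finset.filter_filter, ← Finset.filter_filter] at hsum
  linarith

end Count

/-! ### The bookkeeping of densities with the fourth piece, and the resulting lower density -/

section Assembly

/-- Parameter inequality for the `T`-piece coefficient (as in `cor26_algebra`). [folklore] -/
private theorem resAlg_k1 {θ κ μT : ℝ} (hθ : 0 < θ) (hκ1 : κ ≤ 1) (hμT1 : μT ≤ 1) :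
    (19 / 24 + κ / 12) * μT - θ ≤ ((19 - θ) / 24 + (κ - θ) / 12) * (μT - θ) := by
  have t1 : 0 ≤ θ * (1 - κ) := mul_nonneg hθ.le (by linarith)
  have t2 : 0 ≤ θ * (1 - μT) := mul_nonneg hθ.le (by linarith)
  nlinarith [sq_nonneg θ]

/-- Parameter inequality for the `R`-piece coefficient (as in `cor26_algebra`). [folklore] -/
private theorem resAlg_k2 {θ κ μR : ℝ} (hθ : 0 < θ) (hθκ : θ ≤ κ / 2) (hκ1 : κ ≤ 1)
    (hμR1 : μR ≤ 1) :
    3 / 8 * κ * μR - 19 / 24 * θ ≤ (3 / 8 - θ / 24) * (κ - θ) * (μR - θ) := by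
  have hκθ : 0 ≤ κ - θ := by linarith
  have hc₂ : 0 ≤ 3 / 8 - θ / 24 := by linarith
  have t1 : 0 ≤ θ * (1 - κ) := mul_nonneg hθ.le (by linarith)
  have t3 : 0 ≤ θ * (1 - μR) := mul_nonneg hθ.le (by linarith)
  have t4 : 0 ≤ θ * ((κ - θ) * (1 - μR)) := mul_nonneg hθ.le (mul_nonneg hκθ (by linarith))
  have t5 : 0 ≤ θ ^ 2 * (κ - θ) := mul_nonneg (sq_nonneg θ) hκθ
  have t6 : 0 ≤ θ ^ 2 * (3 / 8 - θ / 24) := mul_nonneg (sq_nonneg θ) hc₂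
  have t8 : 0 ≤ θ * θ ^ 2 := mul_nonneg hθ.le (sq_nonneg θ)
  nlinarith

/-- Parameter inequality for the `P`-piece coefficient. [folklore] -/
private theorem resAlg_k3 {θ μP : ℝ} (hθ : 0 < θ) (hμP1 : μP ≤ 1) :
    3 / 4 * μP - θ ≤ (3 / 4 - θ / 4) * (μP - θ) := by
  have t7 : 0 ≤ θ * (1 - μP) := mul_nonneg hθ.le (by linarith)
  nlinarith [sq_nonneg θ]

/-- The real-arithmetic core of `cor26res_count`'s assembly (`cor26_algebra` with one more piece):
with `θ ≤ ε/7`, `θ ≤ κ/2`, the finite-height inequality (`hcnt`), the density bounds `N_T ≥ (μT - θ)N`,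
`N_U ≥ (κ - θ)N_T`, `N_R ≥ (μR - θ)N`, `N_{U₀} ≥ (κ - θ)N_R`, `N_P ≥ (μP - θ)N`, `N_{T ∖ S₁} ≤ (ν + θ)N`,
`N_{¬W} ≤ θN`, one gets `#{BSD, rank ≤ 1} ≥ (δ - ε) N` for every
`δ ≤ (19/24 + κ/12) μT + 3/8 · κ · μR + 3/4 · μP - ν`.
[cite: BhargavaSkinnerZhang2014, Cor 26 (proof, final display)] [cite: BhargavaSkinner2014, Lemma 16] -/
theorem cor26res_algebra {N NT NU NR NU₀ NP NW NTS G θ κ μT μR μP ν δ ε : ℝ}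
    (hN : 0 ≤ N) (hθ : 0 < θ) (hθε : θ ≤ ε / 7) (hθκ : θ ≤ κ / 2)
    (hκ1 : κ ≤ 1) (hμT1 : μT ≤ 1) (hμR1 : μR ≤ 1) (hμP1 : μP ≤ 1)
    (hcnt : (19 - θ) / 24 * NT + 1 / 12 * NU + (3 / 8 - θ / 24) * NU₀ + (3 / 4 - θ / 4) * NP -
      19 / 6 * NW - NTS ≤ G)
    (h3 : (μT - θ) * N ≤ NT) (h4 : (κ - θ) * NT ≤ NU) (h5 : (μR - θ) * N ≤ NR)
    (h6 : (κ - θ) * NR ≤ NU₀) (hP : (μP - θ) * N ≤ NP) (h7 : NTS ≤ (ν + θ) * N) (h8 : NW ≤ θ * N)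
    (hδ : δ ≤ (19 / 24 + κ / 12) * μT + 3 / 8 * κ * μR + 3 / 4 * μP - ν) :
    (δ - ε) * N ≤ G := by
  have hκθ : 0 ≤ κ - θ := by linarith
  have hc₁ : 0 ≤ (19 - θ) / 24 + (κ - θ) / 12 := by linarith
  have hc₂ : 0 ≤ 3 / 8 - θ / 24 := by linarith
  have hc₃ : 0 ≤ 3 / 4 - θ / 4 := by linarith
  -- chaining the density bounds through the nonnegative coefficients
  have e1 : ((19 - θ) / 24 + (κ - θ) / 12) * ((μT - θ) * N) ≤
      ((19 - θ) / 24 + (κ - θ) / 12) * NT := mul_le_mul_of_nonneg_left h3 hc₁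
  have e2 : (3 / 8 - θ / 24) * ((κ - θ) * NR) ≤ (3 / 8 - θ / 24) * NU₀ :=
    mul_le_mul_of_nonneg_left h6 hc₂
  have e3 : (3 / 8 - θ / 24) * (κ - θ) * ((μR - θ) * N) ≤ (3 / 8 - θ / 24) * (κ - θ) * NR :=
    mul_le_mul_of_nonneg_left h5 (mul_nonneg hc₂ hκθ)
  have e4 : (3 / 4 - θ / 4) * ((μP - θ) * N) ≤ (3 / 4 - θ / 4) * NP :=
    mul_le_mul_of_nonneg_left hP hc₃
  -- the parameter inequalities (losses linear in `θ`), scaled by `N`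
  have k1N := mul_le_mul_of_nonneg_right (resAlg_k1 hθ hκ1 hμT1) hN
  have k2N := mul_le_mul_of_nonneg_right (resAlg_k2 hθ hθκ hκ1 hμR1) hN
  have k3N := mul_le_mul_of_nonneg_right (resAlg_k3 hθ hμP1) hN
  have hθN := mul_le_mul_of_nonneg_right hθε hN
  have hθN0 : 0 ≤ θ * N := mul_nonneg hθ.le hN
  have hδN := mul_le_mul_of_nonneg_right hδ hN
  linarith

/-- **Cor 26 of the source with a fourth piece in the local-condition mode, assembled from its pieces
(parametrised form).** In the notation of `cor26res_count`: suppose Thm 13 bounds the sums of `#Sel₅`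
over `T` and over `U₀` (`h13T`, `h13U₀`: eventually `≤ (6 + η) ×` their numbers, for every `η > 0`),
the local equidistribution count holds on `P` (`hlocP`: eventually `Σ_P (#Z(E) - 1) ≤ (1 + η)·N_P`,
for every `η > 0`; Bhargava–Skinner Thm 7 (ii) and Lemma 16 with the average `#Sel₅ = 6`), `T`, `R`,
`P` have lower densities `≥ μT`, `≥ μR`, `≥ μP` (`hT`, `hR`, `hPd`), `U` has relative lower density
`≥ κ` in `T` and `U₀` in `R` (`hκU`, `hκU₀`, Thm 16), `T ∖ S₁` has upper density `≤ ν` (`hν`) and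
the complement of `W` has density `0` (`hW`). Then at least a proportion
`δ = (19/24 + κ/12) μT + 3/8 · κ · μR + 3/4 · μP - ν` of all curves satisfy
`SatisfiesBSDRankLeOne`. [cite: BhargavaSkinnerZhang2014, Cor 26 (proof)]
[cite: BhargavaSkinner2014, Thm 7 (ii) and Lemma 16] [cite: Kim2022, Thm 1.1] -/
theorem heightDensityGE_satisfiesBSDRankLeOne_of_resPieces
    (hGZK : rank_eq_analyticRank_of_analyticRank_le_one)
    (hDD : even_selmerRank_sub_torsionRank_iff) (S₀ T U R U₀ P S₁ W : ℤ × ℤ → Prop)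
    (Z : (AB : ℤ × ℤ) → AddSubgroup ((shortWeierstrass AB).selmerGroup 5))
    (hTS₀ : ∀ AB, T AB → S₀ AB) (hUT : ∀ AB, U AB → T AB)
    (hRS₀ : ∀ AB, R AB → S₀ AB) (hRT : ∀ AB, R AB → ¬ T AB) (hU₀R : ∀ AB, U₀ AB → R AB)
    (hPS₀ : ∀ AB, P AB → S₀ AB) (hPT : ∀ AB, P AB → ¬ T AB) (hPR : ∀ AB, P AB → ¬ R AB)
    (hU : ∀ AB, U AB → U (negB AB))
    (hUflip : ∀ AB, U AB →
      (shortWeierstrass (negB AB)).rootNumber = -(shortWeierstrass AB).rootNumber)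
    (hU₀ : ∀ AB, U₀ AB → U₀ (negB AB))
    (hU₀flip : ∀ AB, U₀ AB →
      (shortWeierstrass (negB AB)).rootNumber = -(shortWeierstrass AB).rootNumber)
    (h5 : ∀ AB, IsInHeightFamily AB → S₀ AB → W AB →
      Nat.card ((shortWeierstrass AB).selmerGroup 5) = 1 →
        (shortWeierstrass AB).mordellWeilRank = 0 ∧ (shortWeierstrass AB).analyticRank = 0)
    (h9 : ∀ AB, IsInHeightFamily AB → T AB → S₁ AB → W AB →
      Nat.card ((shortWeierstrass AB).selmerGroup 5) = 5 →
        (shortWeierstrass AB).mordellWeilRank = 1 ∧ (shortWeierstrass AB).analyticRank = 1)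
    (hker : ∀ AB, IsInHeightFamily AB → P AB →
      Nat.card ((shortWeierstrass AB).selmerGroup 5) ≤ 5 * Nat.card (Z AB))
    (hKim : ∀ AB, IsInHeightFamily AB → P AB → W AB →
      Nat.card ((shortWeierstrass AB).selmerGroup 5) = 5 → Nat.card (Z AB) = 1 →
        (shortWeierstrass AB).mordellWeilRank = 1 ∧ (shortWeierstrass AB).analyticRank = 1)
    (hWtors : ∀ AB, IsInHeightFamily AB → W AB → (shortWeierstrass AB).toAffine.Point[(5 : ℤ)] = ⊥)
    (h13T : ∀ η : ℝ, 0 < η → ∀ᶠ X : ℕ in atTop,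
      ∑ AB ∈ (heightFamilyBelow X).filter T,
          (Nat.card ((shortWeierstrass AB).selmerGroup 5) : ℝ) ≤
        (6 + η) * ((heightFamilyBelow X).filter T).card)
    (h13U₀ : ∀ η : ℝ, 0 < η → ∀ᶠ X : ℕ in atTop,
      ∑ AB ∈ (heightFamilyBelow X).filter U₀,
          (Nat.card ((shortWeierstrass AB).selmerGroup 5) : ℝ) ≤
        (6 + η) * ((heightFamilyBelow X).filter U₀).card)
    (hlocP : ∀ η : ℝ, 0 < η → ∀ᶠ X : ℕ in atTop,
      ∑ AB ∈ (heightFamilyBelow X).filter P, ((Nat.card (Z AB) : ℝ) - 1) ≤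
        (1 + η) * ((heightFamilyBelow X).filter P).card)
    {μT κ μR μP ν : ℝ} (hκ : 0 < κ) (hκ1 : κ ≤ 1) (hμT1 : μT ≤ 1) (hμR1 : μR ≤ 1) (hμP1 : μP ≤ 1)
    (hT : ∀ η : ℝ, 0 < η → ∀ᶠ X : ℕ in atTop,
      (μT - η) * (heightFamilyBelow X).card ≤ ((heightFamilyBelow X).filter T).card)
    (hκU : ∀ η : ℝ, 0 < η → ∀ᶠ X : ℕ in atTop,
      (κ - η) * ((heightFamilyBelow X).filter T).card ≤ ((heightFamilyBelow X).filter U).card)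
    (hR : ∀ η : ℝ, 0 < η → ∀ᶠ X : ℕ in atTop,
      (μR - η) * (heightFamilyBelow X).card ≤ ((heightFamilyBelow X).filter R).card)
    (hκU₀ : ∀ η : ℝ, 0 < η → ∀ᶠ X : ℕ in atTop,
      (κ - η) * ((heightFamilyBelow X).filter R).card ≤ ((heightFamilyBelow X).filter U₀).card)
    (hPd : ∀ η : ℝ, 0 < η → ∀ᶠ X : ℕ in atTop,
      (μP - η) * (heightFamilyBelow X).card ≤ ((heightFamilyBelow X).filter P).card)
    (hν : ∀ η : ℝ, 0 < η → ∀ᶠ X : ℕ in atTop,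
      (((heightFamilyBelow X).filter (fun AB ↦ T AB ∧ ¬ S₁ AB)).card : ℝ) ≤
        (ν + η) * (heightFamilyBelow X).card)
    (hW : ∀ η : ℝ, 0 < η → ∀ᶠ X : ℕ in atTop,
      (((heightFamilyBelow X).filter (fun AB ↦ ¬ W AB)).card : ℝ) ≤ η * (heightFamilyBelow X).card)
    {δ : ℝ} (hδ : δ ≤ (19 / 24 + κ / 12) * μT + 3 / 8 * κ * μR + 3 / 4 * μP - ν) :
    HeightDensityGE SatisfiesBSDRankLeOne δ := by
  intro ε hε
  have hθ : 0 < min (ε / 7) (κ / 2) := lt_min (by positivity) (by positivity)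
  have hθε : min (ε / 7) (κ / 2) ≤ ε / 7 := min_le_left _ _
  have hθκ : min (ε / 7) (κ / 2) ≤ κ / 2 := min_le_right _ _
  filter_upwards [h13T _ hθ, h13U₀ _ hθ, hlocP _ hθ, hT _ hθ, hκU _ hθ, hR _ hθ, hκU₀ _ hθ, hPd _ hθ,
    hν _ hθ, hW _ hθ, eventually_heightFamilyBelow_card_pos]
    with X hX1 hX2 hXP hX3 hX4 hX5 hX6 hXPd hX7 hX8 hXpos
  have hcnt := cor26res_count hGZK hDD S₀ T U R U₀ P S₁ W Z hTS₀ hUT hRS₀ hRT hU₀R hPS₀ hPT hPR hU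
    hUflip hU₀ hU₀flip h5 h9 hker hKim hWtors X hX1 hX2 hXP
  have hN : (0 : ℝ) < (heightFamilyBelow X).card := by exact_mod_cast hXpos
  rw [heightProportion_eq_card_div, le_div_iff₀ hN]
  exact cor26res_algebra hN.le hθ hθε hθκ hκ1 hμT1 hμR1 hμP1 hcnt hX3 hX4 hX5 hX6 hXPd hX7 hX8 hδ

/-- **The rank part at the constant `c_rank = 3059480216411717/4576171406400000 = 0.66856766…`, from
the pieces** (the bundle `pub-bsdpct`'s Theorem A′, in the tree's vocabulary). Specialising
`heightDensityGE_satisfiesBSDRankLeOne_of_resPieces` to the audited exact densities: `T` = (a clopen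
truncation of) `S₀(5) ∩ S₁'(5)`, `μT = μ(S₁'(5)) = 747265625/953369043 = .7838157…` (Lemma 18 of the
source with the residue count corrected to `2(p-1)²`, cf. `bsz_mu_S_one_prime_five`); `R` = the
Tate-fifth-power set `T₅` (split multiplicative reduction at `5`, `5 ∣ ord₅ Δ`, `E(ℚ₅)[5] ≠ 0`; run in
the rank-`0` mode), `μR = μ(T₅) = 78125/3813476172 = 2.0486…·10⁻⁵`; `P` = the slice
`SP′_K = (S₀(5) ∖ (S₁'(5) ∪ T₅)) ∩ {ord₅ Δ ≤ K}` for some `K ≥ 9` (compact `5`-adic condition set,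
as the local equidistribution count requires; on it `E(ℚ₅)[5] = 0`, the bundle's Lemma 4.3, whence
`hker`), `μP = μ(SP′) - 10⁻⁶ = 20546875/1271158724 - 10⁻⁶` (tail `μ(S₀(5) ∩ {ord₅ Δ > K}) =
4c₅/5^{K+2} < 10⁻⁶`); `κ = .5501` (Thm 16); `ν = 10⁻⁵` (display (2), Lemma 19). On `P ∩ W` the
rank-`0` converse (`h5` on `S₀ ∩ W`) is Skinner 2016 Thm C / Skinner–Urban, and the rank-`1`
converse under the local condition (`hKim`) is Kim 2023 Thm 1.1 — (`PRC`) by Thm 2.3 there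
(Bertolini–Darmon–Venerucci Thm A; `E` semistable at the odd prime `5`), (`IMC[1/p]`) at the
multiplicative prime `5` by the bundle's Prop. 3.4 (Skinner 2016 Thm A, Kato, Rubin, Kobayashi /
Perrin-Riou), (`cork1`) from `E(ℚ)[5] = 0` and `#Sel₅ = 5`, (`res`) from `Z = 0`. The assembly gives
`(19/24 + .5501/12) × .7838157… + 3/8 × .5501 × 2.05·10⁻⁵ + 3/4 × (.0161639 - 10⁻⁶) - 10⁻⁵
= .6685685… ≥ 3059480216411717/4576171406400000`, the latter being the bundle's printed `X_{A′}`
(`= (19/24 + κ/12)·μ(S₁'(5)) + 3/8·κ·μ(T₅) + 3/4·μ(SP′) - 7/6·10⁻⁵`). The conclusion is literally the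
binder `hA` of `heightDensityGE_rankLeOne_and_fullBSDOffSgoPrime_cRank_of_sieve` and of
`heightDensityGE_rankLeOne_and_fullBSDOffSmPrime_cRank_of_sieve`.
[cite: BhargavaSkinnerZhang2014, Cor 26 (proof) with Lemma 18 corrected, Thm 16, display (2)]
[cite: BhargavaSkinner2014, Thm 7 (ii) and Lemma 16] [cite: Kim2022, Thm 1.1 and Thm 2.3]
[cite: Skinner2016PacificMC, Thm A and Thm C] -/
theorem bsz_rankLeOne_cRank_of_pieces
    (hGZK : rank_eq_analyticRank_of_analyticRank_le_one)
    (hDD : even_selmerRank_sub_torsionRank_iff) (S₀ T U R U₀ P S₁ W : ℤ × ℤ → Prop)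
    (Z : (AB : ℤ × ℤ) → AddSubgroup ((shortWeierstrass AB).selmerGroup 5))
    (hTS₀ : ∀ AB, T AB → S₀ AB) (hUT : ∀ AB, U AB → T AB)
    (hRS₀ : ∀ AB, R AB → S₀ AB) (hRT : ∀ AB, R AB → ¬ T AB) (hU₀R : ∀ AB, U₀ AB → R AB)
    (hPS₀ : ∀ AB, P AB → S₀ AB) (hPT : ∀ AB, P AB → ¬ T AB) (hPR : ∀ AB, P AB → ¬ R AB)
    (hU : ∀ AB, U AB → U (negB AB))
    (hUflip : ∀ AB, U AB →
      (shortWeierstrass (negB AB)).rootNumber = -(shortWeierstrass AB).rootNumber)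
    (hU₀ : ∀ AB, U₀ AB → U₀ (negB AB))
    (hU₀flip : ∀ AB, U₀ AB →
      (shortWeierstrass (negB AB)).rootNumber = -(shortWeierstrass AB).rootNumber)
    (h5 : ∀ AB, IsInHeightFamily AB → S₀ AB → W AB →
      Nat.card ((shortWeierstrass AB).selmerGroup 5) = 1 →
        (shortWeierstrass AB).mordellWeilRank = 0 ∧ (shortWeierstrass AB).analyticRank = 0)
    (h9 : ∀ AB, IsInHeightFamily AB → T AB → S₁ AB → W AB →
      Nat.card ((shortWeierstrass AB).selmerGroup 5) = 5 →
        (shortWeierstrass AB).mordellWeilRank = 1 ∧ (shortWeierstrass AB).analyticRank = 1)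
    (hker : ∀ AB, IsInHeightFamily AB → P AB →
      Nat.card ((shortWeierstrass AB).selmerGroup 5) ≤ 5 * Nat.card (Z AB))
    (hKim : ∀ AB, IsInHeightFamily AB → P AB → W AB →
      Nat.card ((shortWeierstrass AB).selmerGroup 5) = 5 → Nat.card (Z AB) = 1 →
        (shortWeierstrass AB).mordellWeilRank = 1 ∧ (shortWeierstrass AB).analyticRank = 1)
    (hWtors : ∀ AB, IsInHeightFamily AB → W AB → (shortWeierstrass AB).toAffine.Point[(5 : ℤ)] = ⊥)
    (h13T : ∀ η : ℝ, 0 < η → ∀ᶠ X : ℕ in atTop,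
      ∑ AB ∈ (heightFamilyBelow X).filter T,
          (Nat.card ((shortWeierstrass AB).selmerGroup 5) : ℝ) ≤
        (6 + η) * ((heightFamilyBelow X).filter T).card)
    (h13U₀ : ∀ η : ℝ, 0 < η → ∀ᶠ X : ℕ in atTop,
      ∑ AB ∈ (heightFamilyBelow X).filter U₀,
          (Nat.card ((shortWeierstrass AB).selmerGroup 5) : ℝ) ≤
        (6 + η) * ((heightFamilyBelow X).filter U₀).card)
    (hlocP : ∀ η : ℝ, 0 < η → ∀ᶠ X : ℕ in atTop,
      ∑ AB ∈ (heightFamilyBelow X).filter P, ((Nat.card (Z AB) : ℝ) - 1) ≤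
        (1 + η) * ((heightFamilyBelow X).filter P).card)
    (hT : ∀ η : ℝ, 0 < η → ∀ᶠ X : ℕ in atTop,
      (747265625 / 953369043 - η) * (heightFamilyBelow X).card ≤
        ((heightFamilyBelow X).filter T).card)
    (hκU : ∀ η : ℝ, 0 < η → ∀ᶠ X : ℕ in atTop,
      (0.5501 - η) * ((heightFamilyBelow X).filter T).card ≤ ((heightFamilyBelow X).filter U).card)
    (hR : ∀ η : ℝ, 0 < η → ∀ᶠ X : ℕ in atTop,
      (78125 / 3813476172 - η) * (heightFamilyBelow X).card ≤ ((heightFamilyBelow X).filter R).card)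
    (hκU₀ : ∀ η : ℝ, 0 < η → ∀ᶠ X : ℕ in atTop,
      (0.5501 - η) * ((heightFamilyBelow X).filter R).card ≤ ((heightFamilyBelow X).filter U₀).card)
    (hPd : ∀ η : ℝ, 0 < η → ∀ᶠ X : ℕ in atTop,
      (20546875 / 1271158724 - 1 / 1000000 - η) * (heightFamilyBelow X).card ≤
        ((heightFamilyBelow X).filter P).card)
    (hν : ∀ η : ℝ, 0 < η → ∀ᶠ X : ℕ in atTop,
      (((heightFamilyBelow X).filter (fun AB ↦ T AB ∧ ¬ S₁ AB)).card : ℝ) ≤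
        (0.00001 + η) * (heightFamilyBelow X).card)
    (hW : ∀ η : ℝ, 0 < η → ∀ᶠ X : ℕ in atTop,
      (((heightFamilyBelow X).filter (fun AB ↦ ¬ W AB)).card : ℝ) ≤ η * (heightFamilyBelow X).card) :
    HeightDensityGE SatisfiesBSDRankLeOne (3059480216411717 / 4576171406400000) :=
  heightDensityGE_satisfiesBSDRankLeOne_of_resPieces hGZK hDD S₀ T U R U₀ P S₁ W Z hTS₀ hUT hRS₀ hRT
    hU₀R hPS₀ hPT hPR hU hUflip hU₀ hU₀flip h5 h9 hker hKim hWtors h13T h13U₀ hlocP (by norm_num)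
    (by norm_num) (by norm_num) (by norm_num) (by norm_num) hT hκU hR hκU₀ hPd hν hW (by norm_num)

/-- The value of the constant: `(19/24 + .5501/12)·μ(S₁'(5)) + 3/8·.5501·μ(T₅) + 3/4·(μ(SP′) - 10⁻⁶)
- 10⁻⁵ ≥ c_rank = 3059480216411717/4576171406400000` (margin `9.1·10⁻⁷`), and `c_rank > 0.6685`,
`c_rank > 0.6648` (the source's printed constant), `c_rank > 0.6597` (the corrected constant of the
printed argument, `bhargava_skinner_zhang_corrected_of_pieces`).
[cite: BhargavaSkinnerZhang2014, Cor 26 (final display) with Lemmas 17–18 (Lemma 18 corrected) and display (2)] -/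
theorem bsz_cRank_value :
    (3059480216411717 : ℝ) / 4576171406400000 ≤
        (19 / 24 + 0.5501 / 12) * (747265625 / 953369043) + 3 / 8 * 0.5501 * (78125 / 3813476172) +
          3 / 4 * (20546875 / 1271158724 - 1 / 1000000) - 0.00001 ∧
      (0.6685 : ℝ) < 3059480216411717 / 4576171406400000 ∧
      (0.6648 : ℝ) < 3059480216411717 / 4576171406400000 ∧
      (0.6597 : ℝ) < 3059480216411717 / 4576171406400000 := by
  refine ⟨by norm_num, by norm_num, by norm_num, by norm_num⟩

/-- **`c_rank` is exactly the bundle's Theorem A′ expression**: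
`3059480216411717/4576171406400000 = (19/24 + κ/12)·μ(S₁'(5)) + 3/8·κ·μ(T₅) + 3/4·μ(SP′) - 7/6·ν`
with `κ = .5501`, `μ(S₁'(5)) = 747265625/953369043`, `μ(T₅) = 78125/3813476172`,
`μ(SP′) = 20546875/1271158724`, `ν = 10⁻⁵` — `7/6` being the bundle's coefficient on `ν` (the
source's final display of the proof of Cor 26, `… - (7/8 + 19/24) × .00001 + …`, charges `ν` with
`5/3`; the tree's `cor26_algebra` / `cor26res_algebra` charge it once), and with NO truncation charge
(the truncation `SP′ → SP′_K` costs `3/4·10⁻⁶` in `bsz_rankLeOne_cRank_of_pieces`, which charges `ν`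
once; hence that theorem's margin `7/6·10⁻⁵ - 10⁻⁵ - 3/4·10⁻⁶ = 9.1(6)·10⁻⁷`).
[cite: BhargavaSkinnerZhang2014, Cor 26 (final display) with Lemma 18 corrected] -/
theorem bsz_cRank_eq :
    (3059480216411717 : ℝ) / 4576171406400000 =
      (19 / 24 + 0.5501 / 12) * (747265625 / 953369043) + 3 / 8 * 0.5501 * (78125 / 3813476172) +
        3 / 4 * (20546875 / 1271158724) - 7 / 6 * 0.00001 := by
  norm_num

/-- **The three audited densities partition Lemma 17's `μ(S₀(5))`**:
`μ(S₁'(5)) + μ(T₅) + μ(SP′) = 747265625/953369043 + 78125/3813476172 + 20546875/1271158724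
= 1953125/2441406 = 4·5¹⁰/(5(5¹⁰ - 1))`, the height density of `{5 ∤ A}` = `S₀(5)`
(`hasHeightDensity_not_five_dvd` of `LeadingTermBSZLocalDensityProofs`) — consistent with
`T = S₀(5) ∩ S₁'(5)`, `R = T₅`, `P = SP′ = S₀(5) ∖ (S₁'(5) ∪ T₅)` being a partition of `S₀(5)`
(before the truncation of `P`). [cite: BhargavaSkinnerZhang2014, Lemma 17 with Lemma 18 corrected] -/
theorem bsz_resCell_partition_value :
    (747265625 : ℝ) / 953369043 + 78125 / 3813476172 + 20546875 / 1271158724 = 1953125 / 2441406 ∧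
      (1953125 : ℝ) / 2441406 = 4 * 5 ^ 10 / (5 * (5 ^ 10 - 1)) := by
  constructor <;> norm_num

end Assembly

end Literature.NumberTheory.EllipticCurves

end
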